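import Summits.QuantumFields.YangMills.Theorems.BalabanUVNodesN15TwoSpacingGluingCurvedKnitObjects
import Summits.QuantumFields.YangMills.Theorems.BalabanUVNodesN15CovariantLandauObjects
import HarnessLib

/-!
# N15 = NE2, road (c) — PROGRAMME (PC) «[B9] Sect. C FOR THE LANDAU LETTER WITH PER-CUBE GAUGES (3.35) AS PRINTED», FILE A: THE OBJECTS OF THE SCALAR
# COVARIANT GREEN's FUNCTION KNIT — dag-n15-w3's dressed smooth-cut random walk (capstone 52) on the SCALAR carrier `Tor (fine L^k (2L^{m+1})) × ι` of the
# gauge parameters, with the flat nonlocal part `N_L := a·Q′ᵀQ′ ⊗ 1_ι` and the cube operators `N_k := (G′(1) ⊗ 1_ι)∘M_{ψ_k}` (dag-n15-c g26, n15-c∕260′ = the FINE-GRID twin of n15-c∕260 at spacing `L^{−r}L^{−k}`)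

Cell `pub-ymgap`, seat `pub-ymgap-dag-n15-c` (generation g26; R134 (a) seat, strategy s1 «first missing estimate»; HUMAN RULING D-0062; chair R424 venue).
`bears_on: R4∕N15 · K3⁸ SpineGivenEndpointR13SepCoPHV (stmt-QuantumFields-27366)`; filed `--supports stmt-QuantumFields-27366 --as helper` — COUNT-NEUTRAL.
Plumbing `abbrev`s∕`def`s + `rfl`-level dictionary; 0 `sorry`, NO estimate.  Imports BY NAME n15-c∕119 `…TwoSpacingGluingCurvedKnitObjects` (`cvM`, `cvSk`, the
cover's windows; through it FILE 70 `knitH`∕`coverMargin`, FILE 66∕67 `coverXi`∕`coverCorner`∕`coverHb`, dag-n15-a `chiCube`∕`cubeBlocks`, dag-n15-w4 `hcube`∕`bcube`,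
dag-n15-w3 52 `…SmoothCutDressedGluedGaugedUN` and its vocabulary `glueInv`∕`parametrix`∕`remainder`∕`bgPropV`∕`stack`∕`unstackM`∕`tCoefC`∕`tCoefA`∕`covLapM`∕`gaugePair`∕
`mmulOp`∕`coordMat`) and n15-c∕197 `…CovariantLandauObjects` (`csavg`, `cGreen`: the covariant block averaging `Q′(U)` of (3.19) and `G′(U) = (Δ′_a(U))⁻¹` of (3.25)).
Nothing in the tree is modified, no landed name re-declared.

WHY (the located object of HOME HANDOFF § g25 «LOCATED NEXT ∕ CORRECTION ∕ CAVEAT», programme (PC)).  Road (c)'s one-propagator literal is closed at MODEL level (n15-c∕258) in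
the GLOBAL small-field gauge: one potential `A′` with the (3.35) letters everywhere.  The print's class (3.35) ([Balaban1985BackgroundPropagators] p.396) is PER CUBE — «for an
arbitrary cube □ of the class … there exists a gauge transformation u on □ such that U^u = e^{iηA} and |A| < O(1)Mα₀(Lʲη)⁻¹ …» — with no constraint tying the gauges of different
cubes; Sect. C (pp.408–410) localises by the generalized random walk (3.87)–(3.90): *«Theorem 3.7. For M sufficiently large, and a configuration U satisfying (3.35), the operator
G′ can be represented as G′ = G′₀(I − R′)⁻¹ = Σ_ω h_{□₀}G′_{□₀}h_{□₀}K(h_{□₁})G′_{□₁}h_{□₁}…»* with the local operators supplied by Cor. 3.6 «all the results of these theorems are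
gauge invariant».  The Landau letter `N_V^R = D_U(I − R(U))D*_U − flat` of the (P-R) programme contains the GLOBAL inverses `G′(U) = (D*_UD_U + aQ′*_UQ′_U)⁻¹` and `(Q′G′²Q′*)⁻¹`
on the SCALAR fields (gauge parameters); their decay for `U` in the per-cube class is the first input of every box-local row of `N_V^R` (HOME HANDOFF § g25 (2)–(3)).  dag-n15-w3's
capstone 52 `CurvedSpecies.uN_hasMaj_glueInv_smoothCutDressed_localGauges(_inverse)` IS the random walk (3.90) with per-cube gauges on an ABSTRACT carrier `X × ι`; n15-c∕119–120
instantiated it on the BOND carrier for `Δ_{R_U} + P`.  THIS FILE types its objects on the SITE carrier for `Δ′_a(U) = D*_UD_U + aQ′*_UQ′_U`: the local propagators are the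
componentwise torus Green's function `G′(1) ⊗ 1_ι` (dag-n15-a Ξ-4 `flatRowsAll_king`, King's rung) compressed to the cube's plateau `ψ_k` (so 52's exact locality `hloc0` is
`M_{h_k}Δ′_a(1)G′(1)M_{ψ_k} = M_{h_k}M_{ψ_k} = M_{h_k}`), and the flat nonlocal part is the BLOCK-DIAGONAL `a·Q′ᵀQ′ ⊗ 1_ι` (so 52's tail row `hT` vanishes identically and the
commutator row `hKN` is the in-block oscillation of `h_k`).  Sequel: FILE B (the rows), FILE C (the knit `uN_scGlued'_spec`), FILE D (`P := a·Q′_Tᵀ Q′_T` live, gauges from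
`Reg335Cube` per cube ⇒ the decay of `G′(U)` for `U` in the printed class).

OBJECTS ([folklore] plumbing unless tagged; equation tags mark the printed formula an object transcribes — nothing printed is asserted).
* §1 `ScX'` (sites of `Tor (fine L^k (cvM))`), `scBlk'` (unit blocks), `ScNorm'` (dag-n15-w3's sharp block norm on `ScX' × ι`), `scShift' μ = (· + e_μ)`, the multipliers read at the bond
  `(x, 0)` of the cover's bond-carrier objects: `scXi'` (`= coverXi (x, 0)`), `scH'` (`= knitH (x, 0)`, `rfl`), `scChi'`, `scPsi'`, `scBump'`; ★ `scQQ' := mulVecLin (a·(Q′₁ᵀQ′₁))`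
  ((3.24) at `U ≡ 1`: the flat nonlocal part), ★ `scCube' k := mulVecLin (G′(1)) ∘ M_{ψ_k}` ((3.87) shape: the local propagator of the cube `□_k`), ★★ `scGlued'` = 52's
  `glueInv (parametrix …) (remainder … − Σ_k …)` with these data, LITERALLY (n15-c∕119 `cvGlued` with `CvX ↦ ScX'`, `bshiftEquiv ↦ scShift'`, `knitH ↦ scH'`, `cvBump∕cvPsi∕cvChi ↦
  scBump'∕scPsi'∕scChi'`, `cvCube ↦ scCube'`, `cvNL ↦ scQQ'`).
* §2 the `rfl` dictionary `scH'_eq_knitH`, `scXi'_eq_coverXi`, `scShift'_apply`, `scShift'_symm_apply`, `liftBlk_scBlk'`.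

HONEST FRAMING ∕ LIMITS.  Definitions only; no analytic estimate; MODEL carriers (the doubled-cube torus cover of FILE 70, one scale, unit weights; the local propagators are
dressed TORUS propagators `G′(1)`, not the print's `G′_□` for the sequences `{Ω_n(□)}` of p.408); [B9] (3.19) p.393, (3.24)–(3.25) p.394, (3.35) p.396, (3.62)–(3.65)
pp.402–403, (3.87)–(3.90) pp.409–410 = SHAPES ∕ MECHANISM, nothing of [B5]∕[B6]∕[B9] asserted.  NE2⁺ NOT PRINTED, NOT proved; N15 of record untouched (DISCHARGED AS
CONSUMED, p687738); K3⁸ OPEN; counts of record UNMOVED (typed 28∕28 · discharged 8∕27); one finite 𝕋⁴ at fixed ε per index — NOT infinite volume, NOT OS on ℝ⁴, NOT a mass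
gap, NOT Clay; R4 closes the conditional finite-𝕋⁴ rung `BalabanLadder.UV` only.  Restate-immune (no Theses import).
-/

noncomputable section

open scoped BigOperators Matrix Matrix.Norms.Frobenius

namespace Summit.QuantumFields.YangMills.BalabanUVNodes.N15.Gluing

open Real
open Literature.MathematicalPhysics.QuantumFieldTheory.Balaban1983to89
open Literature.MathematicalPhysics.QuantumFieldTheory.Balaban1983to89.B5Prop11Plancherel (Tor fine unitVec)
open Literature.MathematicalPhysics.QuantumFieldTheory.Balaban1983to89.B11SectG (BlockNorm HasMaj RowSum)
open Literature.MathematicalPhysics.QuantumFieldTheory.Balaban1983to89.B6Prop26Gluing (mulOp mulOp_apply ind)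
open Literature.MathematicalPhysics.QuantumFieldTheory.Balaban1983to89.B6UnitTorusCarrier (unitTorusGeo)
open Literature.MathematicalPhysics.QuantumFieldTheory.Balaban1983to89.B5SiteBridgeP12 (MP)
open Literature.MathematicalPhysics.QuantumFieldTheory.King1986.Torus (blockOf tdistT)
open Summit.QuantumFields.YangMills.BalabanUVNodes.N15.BackgroundLayer (fgrad fgradAdj bgrad fgrad_apply fgradAdj_apply bgrad_apply stack projO bgPropV covLapM tCoefA tCoefC unstackM)
open Summit.QuantumFields.YangMills.BalabanUVNodes.N15.VectorPiece (bshiftEquiv bshiftEquiv_apply tensorId)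
open Summit.QuantumFields.YangMills.BalabanUVNodes.N15.MatrixSpecies (mmulOp coordMat liftBlk liftEquiv liftEquiv_apply liftEquiv_symm_apply)
open Summit.QuantumFields.YangMills.BalabanUVNodes.N15.TwoGrid (paramsOf chiCube cubeBlocks)
open Summit.QuantumFields.YangMills.BalabanUVNodes.N15.CurvedSpecies (gaugePair)
open Summit.QuantumFields.YangMills.BalabanUVNodes.N15.CovLandau (csavg cGreen)

variable {d : ℕ}

/-! ## §1 The objects of the scalar covariant Green's function knit at the cover -/

section Objects

variable (d) (L : ℕ) [NeZero L]

/-- the SITE carrier: the points of the `L^k`-fine doubled torus `2L·L^m` of the cover (the gauge parameters `λ : T_η → 𝔤` live on `ScX' × ι` in trace-form coordinates).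
[cite: Balaban1985BackgroundPropagators, (3.21)–(3.24) p.394 (shape)] -/
abbrev ScX' (mv kk r : ℕ) (hL : Odd L ∧ 1 < L) : Type := Tor (fine (L ^ r * L ^ kk) (cvM d L mv kk hL))

/-- the unit-block map of the site carrier. [folklore] -/
abbrev scBlk' (mv kk r : ℕ) (hL : Odd L ∧ 1 < L) : ScX' d L mv kk r hL → Tor (cvM d L mv kk hL) := blockOf (L ^ r * L ^ kk) (cvM d L mv kk hL)

/-- dag-n15-w3's sharp block norm on the coloured site carrier `ScX' × ι`. [folklore] -/
abbrev ScNorm' (mv kk r : ℕ) (hL : Odd L ∧ 1 < L) (ι : Type) [Fintype ι] : BlockNorm (unitTorusGeo L kk (cvM d L mv kk hL)) (ScX' d L mv kk r hL × ι → ℝ) :=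
  BlockNorm.ofBlocks (unitTorusGeo L kk (cvM d L mv kk hL)) (liftBlk (scBlk' d L mv kk r hL) ι)

/-- the site shift `x ↦ x + e_μ` as an equivalence. [folklore] -/
abbrev scShift' (mv kk r : ℕ) (hL : Odd L ∧ 1 < L) (μ : Fin (d + 1)) : ScX' d L mv kk r hL ≃ ScX' d L mv kk r hL :=
  Equiv.addRight (unitVec (fine (L ^ r * L ^ kk) (cvM d L mv kk hL)) μ)

/-- the partition coordinates `ξ_ν(x) = val(x_ν)∕(L^k·L^m)` of a SITE, read at the bond `(x, 0)` of FILE 66's `coverXi`. [cite: Balaban1984PropagatorsII, (2.36) p.229 (shape)] -/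
abbrev scXi' (mv kk r : ℕ) (hL : Odd L ∧ 1 < L) (ν : Fin (d + 1)) (x : ScX' d L mv kk r hL) : ℝ := coverXi (cvM d L mv kk hL) (L ^ r * L ^ kk) (L ^ mv) ν (x, 0)

/-- THE PARTITION `h_k` on sites (FILE 70's `knitH` at the bond `(x, 0)`). [cite: Balaban1984PropagatorsII, (2.36) p.229 (shape); Balaban1985BackgroundPropagators, (3.87) p.409] -/
abbrev scH' (mv kk r : ℕ) (hL : Odd L ∧ 1 < L) (k : Fin (d + 1) → ZMod (2 * L)) (x : ScX' d L mv kk r hL) : ℝ := hcube (2 * L) (scXi' d L mv kk r hL) k x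

/-- THE INPUT CUT `χ_k` on sites: the indicator of the blocks of the box `c(2w, k) + [0, 6w+1)^{d+1}` (`w = L^m`). [cite: Balaban1985BackgroundPropagators, (3.62)–(3.65) pp.402–403 (shape)] -/
abbrev scChi' (mv kk r : ℕ) (hL : Odd L ∧ 1 < L) (k : Fin (d + 1) → ZMod (2 * L)) (x : ScX' d L mv kk r hL) : ℝ :=
  chiCube (cvM d L mv kk hL) (L ^ r * L ^ kk) (coverCorner (cvM d L mv kk hL) (L ^ mv) L (2 * L ^ mv) k) (6 * L ^ mv + 1) (x, 0)

/-- THE PLATEAU `ψ_k` on sites: the indicator of the blocks of the cube `□_k = c(m₀, k) + [0, Lw)^{d+1}`. [cite: Balaban1984PropagatorsII, (2.37) p.229 (shape)] -/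
abbrev scPsi' (mv kk r : ℕ) (hL : Odd L ∧ 1 < L) (k : Fin (d + 1) → ZMod (2 * L)) (x : ScX' d L mv kk r hL) : ℝ :=
  chiCube (cvM d L mv kk hL) (L ^ r * L ^ kk) (coverCorner (cvM d L mv kk hL) (L ^ mv) L (coverMargin L mv) k) (L * L ^ mv) (x, 0)

/-- THE SMOOTH CUT `χ̃_k` on sites: dag-n15-w4's radius-2 bump on the site coordinates. [cite: Balaban1985BackgroundPropagators, (3.62)–(3.65) pp.402–403 (shape)] -/
abbrev scBump' (mv kk r : ℕ) (hL : Odd L ∧ 1 < L) (k : Fin (d + 1) → ZMod (2 * L)) (x : ScX' d L mv kk r hL) : ℝ := bcube (2 * L) (scXi' d L mv kk r hL) 2 k x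

/-- ★ THE FLAT NONLOCAL PART `N_L = a·Q′ᵀQ′ ⊗ 1_ι` of `Δ′_a(1) = ∂ᵀ∂ + a·Q′ᵀQ′` (n15-c∕197 `csavg` at `T ≡ 1`; BLOCK-DIAGONAL). [cite: Balaban1985BackgroundPropagators, (3.24) p.394 (at `U ≡ 1`, model weights)] -/
def scQQ' (mv kk r : ℕ) (hL : Odd L ∧ 1 < L) (a : ℝ) (ι : Type) [Fintype ι] [DecidableEq ι] : (ScX' d L mv kk r hL × ι → ℝ) →ₗ[ℝ] (ScX' d L mv kk r hL × ι → ℝ) :=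
  Matrix.mulVecLin (a • ((csavg (cvM d L mv kk hL) (L ^ r * L ^ kk) (fun (_ : Fin (d + 1)) (_ : ScX' d L mv kk r hL) => (1 : Matrix ι ι ℝ)))ᵀ *
    csavg (cvM d L mv kk hL) (L ^ r * L ^ kk) (fun (_ : Fin (d + 1)) (_ : ScX' d L mv kk r hL) => (1 : Matrix ι ι ℝ))))

/-- ★ THE LOCAL PROPAGATOR OF THE CUBE `□_k`: the torus Green's function `G′(1) = (Δ′_a(1))⁻¹` (componentwise in the colour; n15-c∕197 `cGreen` at `T ≡ 1`) compressed to the cube's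
plateau, `N_k := G′(1)∘M_{ψ_k}`. [cite: Balaban1985BackgroundPropagators, (3.87) p.409 (the local operators `G′_□`: shape), (3.25) p.394] -/
def scCube' (mv kk r : ℕ) (hL : Odd L ∧ 1 < L) (a : ℝ) (ι : Type) [Fintype ι] [DecidableEq ι] (k : Fin (d + 1) → ZMod (2 * L)) :
    (ScX' d L mv kk r hL × ι → ℝ) →ₗ[ℝ] (ScX' d L mv kk r hL × ι → ℝ) :=
  Matrix.mulVecLin (cGreen (cvM d L mv kk hL) (L ^ r * L ^ kk) (fun (_ : Fin (d + 1)) (_ : ScX' d L mv kk r hL) => (1 : Matrix ι ι ℝ)) a) ∘ₗ mulOp (fun p : ScX' d L mv kk r hL × ι => scPsi' d L mv kk r hL k p.1)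

/-- ★★ **THE GLUED OPERATOR OF THE SCALAR COVARIANT GREEN's FUNCTION KNIT** — dag-n15-w3 52's `glueInv (parametrix …) (remainder … − Σ_k …)` for `Δ_{R_U} + P` on the SITE carrier with
the cover's data: partition `h_k`, cut `χ_k`, plateau `ψ_k`, bump `χ̃_k`, local propagators `N_k = G′(1)∘M_{ψ_k}`, flat nonlocal part `N_L = a·Q′ᵀQ′ ⊗ 1`, site shifts `· + e_μ`; per-cube
unitary gauges `u_k` (`W_k = coordMat e Ad_{u_k}`), the unitary bond field `U`, the summand `P`, the perturbations `N_V k`, spacing `η` (n15-c∕119 `cvGlued` with the site data, LITERALLY).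
[cite: Balaban1985BackgroundPropagators, (3.87)–(3.90) pp.409–410 (the random walk for `G′`: mechanism), (3.62)–(3.65) pp.402–403; Balaban1984PropagatorsII, (2.91) p.239, (2.133)–(2.136) p.247] -/
def scGlued' (mv kk r : ℕ) (hL : Odd L ∧ 1 < L) (a η : ℝ) (ι : Type) [Fintype ι] [DecidableEq ι] {mm : Type} [Fintype mm] [DecidableEq mm] (e : Matrix mm mm ℂ ≃L[ℝ] (ι → ℝ))
    (u : (Fin (d + 1) → ZMod (2 * L)) → ScX' d L mv kk r hL → Matrix mm mm ℂ) (U : Fin (d + 1) → ScX' d L mv kk r hL → Matrix mm mm ℂ)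
    (P : (ScX' d L mv kk r hL × ι → ℝ) →ₗ[ℝ] (ScX' d L mv kk r hL × ι → ℝ)) (NV : (Fin (d + 1) → ZMod (2 * L)) → (ScX' d L mv kk r hL × ι → ℝ) →ₗ[ℝ] (ScX' d L mv kk r hL × ι → ℝ)) :
    (ScX' d L mv kk r hL × ι → ℝ) →ₗ[ℝ] (ScX' d L mv kk r hL × ι → ℝ) :=
  (glueInv (parametrix (fun k (p : ScX' d L mv kk r hL × ι) => scH' d L mv kk r hL k p.1) (fun k => mmulOp (fun x => (coordMat e (ContinuousLinearMap.mulLeftRight ℝ (Matrix mm mm ℂ) (u k x) (u k x)ᴴ))ᵀ) ∘ₗ (projO none ∘ₗ bgPropV (stack (mulOp (fun p : ScX' d L mv kk r hL × ι => scBump' d L mv kk r hL k p.1) ∘ₗ scCube' d L mv kk r hL a ι k) (fun j => Sum.elim (fun μ => fgrad η⁻¹ (liftEquiv (scShift' d L mv kk r hL μ) ι)) (fun μ => bgrad η⁻¹ (liftEquiv (scShift' d L mv kk r hL μ) ι)) j ∘ₗ (mulOp (fun p : ScX' d L mv kk r hL × ι => scBump' d L mv kk r hL k p.1) ∘ₗ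 scCube' d L mv kk r hL a ι k))) (mulOp (fun p : ScX' d L mv kk r hL × ι => scPsi' d L mv kk r hL k p.1) ∘ₗ (unstackM (tCoefC η (gaugePair (scShift' d L mv kk r hL) fun μ x => coordMat e (ContinuousLinearMap.mulLeftRight ℝ (Matrix mm mm ℂ) (u k x * U μ x * (u k (scShift' d L mv kk r hL μ x))ᴴ) (u k x * U μ x * (u k (scShift' d L mv kk r hL μ x))ᴴ)ᴴ)))
  (tCoefA η (gaugePair (scShift' d L mv kk r hL) fun μ x => coordMat e (ContinuousLinearMap.mulLeftRight ℝ (Matrix mm mm ℂ) (u k x * U μ x * (u k (scShift' d L mv kk r hL μ x))ᴴ) (u k x * U μ x * (u k (scShift' d L mv kk r hL μ x))ᴴ)ᴴ))) + NV k ∘ₗ projO none) ∘ₗ mulOp (fun q : (ScX' d L mv kk r hL × ι) × Option (Fin (d + 1) ⊕ Fin (d + 1)) => scChi' d L mv kk r hL k q.1.1))) ∘ₗ mmulOp (fun x => coordMat e (ContinuousLinearMap.mulLeftRight ℝ (Matrix mm mm ℂ) (u k x) (u k x)ᴴ))))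
  (remainder (covLapM (scShift' d L mv kk r hL) η (gaugePair (scShift' d L mv kk r hL) (fun μ x => coordMat e (ContinuousLinearMap.mulLeftRight ℝ (Matrix mm mm ℂ) (U μ x) (U μ x)ᴴ))) + P) (fun k (p : ScX' d L mv kk r hL × ι) => scH' d L mv kk r hL k p.1) (fun k => mmulOp (fun x => (coordMat e (ContinuousLinearMap.mulLeftRight ℝ (Matrix mm mm ℂ) (u k x) (u k x)ᴴ))ᵀ) ∘ₗ (projO none ∘ₗ bgPropV (stack (mulOp (fun p : ScX' d L mv kk r hL × ι => scBump' d L mv kk r hL k p.1) ∘ₗ scCube' d L mv kk r hL a ι k) (fun j => Sum.elim (fun μ => fgrad η⁻¹ (liftEquiv (scShift' d L mv kk r hL μ) ι)) (fun μ => bgrad η⁻¹ (liftEquiv (scShift' d L mv kk r hL μ) ι)) j ∘ₗ (mulOp (fun p : ScX' d L mv kk r hL × ι => scBump' d L mv kk r hL k p.1) ∘ₗ scCube' d L mv kk r hL a ι k))) (mulOp (fun p : ScX' d L mv kk r hL × ι => scPsi' d L mv kk r hL k p.1) ∘ₗ (unstackM (tCoefC η (gaugePair (scShift' d L mv kk r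 hL) fun μ x => coordMat e (ContinuousLinearMap.mulLeftRight ℝ (Matrix mm mm ℂ) (u k x * U μ x * (u k (scShift' d L mv kk r hL μ x))ᴴ) (u k x * U μ x * (u k (scShift' d L mv kk r hL μ x))ᴴ)ᴴ)))
  (tCoefA η (gaugePair (scShift' d L mv kk r hL) fun μ x => coordMat e (ContinuousLinearMap.mulLeftRight ℝ (Matrix mm mm ℂ) (u k x * U μ x * (u k (scShift' d L mv kk r hL μ x))ᴴ) (u k x * U μ x * (u k (scShift' d L mv kk r hL μ x))ᴴ)ᴴ))) + NV k ∘ₗ projO none) ∘ₗ mulOp (fun q : (ScX' d L mv kk r hL × ι) × Option (Fin (d + 1) ⊕ Fin (d + 1)) => scChi' d L mv kk r hL k q.1.1))) ∘ₗ mmulOp (fun x => coordMat e (ContinuousLinearMap.mulLeftRight ℝ (Matrix mm mm ℂ) (u k x) (u k x)ᴴ))) -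
  ∑ k, (mmulOp (fun x => (coordMat e (ContinuousLinearMap.mulLeftRight ℝ (Matrix mm mm ℂ) (u k x) (u k x)ᴴ))ᵀ) ∘ₗ ((((-(mulOp (fun p : ScX' d L mv kk r hL × ι => scH' d L mv kk r hL k p.1) ∘ₗ scQQ' d L mv kk r hL a ι ∘ₗ mulOp (1 - fun p : ScX' d L mv kk r hL × ι => scBump' d L mv kk r hL k p.1))) ∘ₗ scCube' d L mv kk r hL a ι k) ∘ₗ (LinearMap.id + ((mulOp (fun p : ScX' d L mv kk r hL × ι => scPsi' d L mv kk r hL k p.1) ∘ₗ (unstackM (tCoefC η (gaugePair (scShift' d L mv kk r hL) fun μ x => coordMat e (ContinuousLinearMap.mulLeftRight ℝ (Matrix mm mm ℂ) (u k x * U μ x * (u k (scShift' d L mv kk r hL μ x))ᴴ) (u k x * U μ x * (u k (scShift' d L mv kk r hL μ x))ᴴ)ᴴ)))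
  (tCoefA η (gaugePair (scShift' d L mv kk r hL) fun μ x => coordMat e (ContinuousLinearMap.mulLeftRight ℝ (Matrix mm mm ℂ) (u k x * U μ x * (u k (scShift' d L mv kk r hL μ x))ᴴ) (u k x * U μ x * (u k (scShift' d L mv kk r hL μ x))ᴴ)ᴴ))) + NV k ∘ₗ projO none) ∘ₗ mulOp (fun q : (ScX' d L mv kk r hL × ι) × Option (Fin (d + 1) ⊕ Fin (d + 1)) => scChi' d L mv kk r hL k q.1.1)) ∘ₗ stack LinearMap.id (fun j => Sum.elim (fun μ => fgrad η⁻¹ (liftEquiv (scShift' d L mv kk r hL μ) ι)) (fun μ => bgrad η⁻¹ (liftEquiv (scShift' d L mv kk r hL μ) ι)) j)) ∘ₗ (projO none ∘ₗ bgPropV (stack (mulOp (fun p : ScX' d L mv kk r hL × ι => scBump' d L mv kk r hL k p.1) ∘ₗ scCube' d L mv kk r hL a ι k) (fun j => Sum.elim (fun μ => fgrad η⁻¹ (liftEquiv (scShift' d L mv kk r hL μ) ι)) (fun μ => bgrad η⁻¹ (liftEquiv (scShift' d L mv kk r hL μ) ι)) j ∘ₗ (mulOp (fun p : ScX' d L mv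 kk r hL × ι => scBump' d L mv kk r hL k p.1) ∘ₗ scCube' d L mv kk r hL a ι k))) (mulOp (fun p : ScX' d L mv kk r hL × ι => scPsi' d L mv kk r hL k p.1) ∘ₗ (unstackM (tCoefC η (gaugePair (scShift' d L mv kk r hL) fun μ x => coordMat e (ContinuousLinearMap.mulLeftRight ℝ (Matrix mm mm ℂ) (u k x * U μ x * (u k (scShift' d L mv kk r hL μ x))ᴴ) (u k x * U μ x * (u k (scShift' d L mv kk r hL μ x))ᴴ)ᴴ)))
  (tCoefA η (gaugePair (scShift' d L mv kk r hL) fun μ x => coordMat e (ContinuousLinearMap.mulLeftRight ℝ (Matrix mm mm ℂ) (u k x * U μ x * (u k (scShift' d L mv kk r hL μ x))ᴴ) (u k x * U μ x * (u k (scShift' d L mv kk r hL μ x))ᴴ)ᴴ))) + NV k ∘ₗ projO none) ∘ₗ mulOp (fun q : (ScX' d L mv kk r hL × ι) × Option (Fin (d + 1) ⊕ Fin (d + 1)) => scChi' d L mv kk r hL k q.1.1)))) + mulOp (fun p : ScX' d L mv kk r hL × ι => scH' d L mv kk r hL k p.1) ∘ₗ (-(((unstackM (tCoefC η (gaugePair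 (scShift' d L mv kk r hL) fun μ x => coordMat e (ContinuousLinearMap.mulLeftRight ℝ (Matrix mm mm ℂ) (u k x * U μ x * (u k (scShift' d L mv kk r hL μ x))ᴴ) (u k x * U μ x * (u k (scShift' d L mv kk r hL μ x))ᴴ)ᴴ)))
  (tCoefA η (gaugePair (scShift' d L mv kk r hL) fun μ x => coordMat e (ContinuousLinearMap.mulLeftRight ℝ (Matrix mm mm ℂ) (u k x * U μ x * (u k (scShift' d L mv kk r hL μ x))ᴴ) (u k x * U μ x * (u k (scShift' d L mv kk r hL μ x))ᴴ)ᴴ))) + NV k ∘ₗ projO none) - mulOp (fun p : ScX' d L mv kk r hL × ι => scPsi' d L mv kk r hL k p.1) ∘ₗ (unstackM (tCoefC η (gaugePair (scShift' d L mv kk r hL) fun μ x => coordMat e (ContinuousLinearMap.mulLeftRight ℝ (Matrix mm mm ℂ) (u k x * U μ x * (u k (scShift' d L mv kk r hL μ x))ᴴ) (u k x * U μ x * (u k (scShift' d L mv kk r hL μ x))ᴴ)ᴴ)))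
  (tCoefA η (gaugePair (scShift' d L mv kk r hL) fun μ x => coordMat e (ContinuousLinearMap.mulLeftRight ℝ (Matrix mm mm ℂ) (u k x * U μ x * (u k (scShift' d L mv kk r hL μ x))ᴴ) (u k x * U μ x * (u k (scShift' d L mv kk r hL μ x))ᴴ)ᴴ))) + NV k ∘ₗ projO none) ∘ₗ mulOp (fun q : (ScX' d L mv kk r hL × ι) × Option (Fin (d + 1) ⊕ Fin (d + 1)) => scChi' d L mv kk r hL k q.1.1)) ∘ₗ stack LinearMap.id (fun j => Sum.elim (fun μ => fgrad η⁻¹ (liftEquiv (scShift' d L mv kk r hL μ) ι)) (fun μ => bgrad η⁻¹ (liftEquiv (scShift' d L mv kk r hL μ) ι)) j))) ∘ₗ (projO none ∘ₗ bgPropV (stack (mulOp (fun p : ScX' d L mv kk r hL × ι => scBump' d L mv kk r hL k p.1) ∘ₗ scCube' d L mv kk r hL a ι k) (fun j => Sum.elim (fun μ => fgrad η⁻¹ (liftEquiv (scShift' d L mv kk r hL μ) ι)) (fun μ => bgrad η⁻¹ (liftEquiv (scShift' d L mv kk r hL μ) ι)) j ∘ₗ (mulOp (fun p : ScX' d L mv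 kk r hL × ι => scBump' d L mv kk r hL k p.1) ∘ₗ scCube' d L mv kk r hL a ι k))) (mulOp (fun p : ScX' d L mv kk r hL × ι => scPsi' d L mv kk r hL k p.1) ∘ₗ (unstackM (tCoefC η (gaugePair (scShift' d L mv kk r hL) fun μ x => coordMat e (ContinuousLinearMap.mulLeftRight ℝ (Matrix mm mm ℂ) (u k x * U μ x * (u k (scShift' d L mv kk r hL μ x))ᴴ) (u k x * U μ x * (u k (scShift' d L mv kk r hL μ x))ᴴ)ᴴ)))
  (tCoefA η (gaugePair (scShift' d L mv kk r hL) fun μ x => coordMat e (ContinuousLinearMap.mulLeftRight ℝ (Matrix mm mm ℂ) (u k x * U μ x * (u k (scShift' d L mv kk r hL μ x))ᴴ) (u k x * U μ x * (u k (scShift' d L mv kk r hL μ x))ᴴ)ᴴ))) + NV k ∘ₗ projO none) ∘ₗ mulOp (fun q : (ScX' d L mv kk r hL × ι) × Option (Fin (d + 1) ⊕ Fin (d + 1)) => scChi' d L mv kk r hL k q.1.1))))) ∘ₗ mmulOp (fun x => coordMat e (ContinuousLinearMap.mulLeftRight ℝ (Matrix mm mm ℂ) (u k x) (u k x)ᴴ)))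 ∘ₗ mulOp (fun p : ScX' d L mv kk r hL × ι => scH' d L mv kk r hL k p.1)))

end Objects

/-! ## §2 The `rfl` dictionary to the bond-carrier objects -/

section Dictionary

variable {L : ℕ} {mv kk r : ℕ} {hL : Odd L ∧ 1 < L}

/-- `h_k` on sites IS FILE 70's `knitH` at the bond `(x, 0)`. [folklore] -/
theorem scH'_eq_knitH (k : Fin (d + 1) → ZMod (2 * L)) (x : ScX' d L mv kk r hL) : scH' d L mv kk r hL k x = knitH d L mv kk (L ^ r * L ^ kk) hL k (x, 0) := rfl

/-- the site coordinates ARE FILE 66's bond coordinates at `(x, 0)`. [folklore] -/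
theorem scXi'_eq_coverXi (ν : Fin (d + 1)) (x : ScX' d L mv kk r hL) : scXi' d L mv kk r hL ν x = coverXi (cvM d L mv kk hL) (L ^ r * L ^ kk) (L ^ mv) ν (x, 0) := rfl

/-- the site shift and the bond shift agree on the first factor. [folklore] -/
theorem scShift'_apply (μ : Fin (d + 1)) (x : ScX' d L mv kk r hL) :
    (scShift' d L mv kk r hL μ x, (0 : Fin (d + 1))) = bshiftEquiv (cvM d L mv kk hL) (L ^ r * L ^ kk) μ (x, 0) := rfl

/-- … and so do their inverses. [folklore] -/
theorem scShift'_symm_apply (μ : Fin (d + 1)) (x : ScX' d L mv kk r hL) :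
    ((scShift' d L mv kk r hL μ).symm x, (0 : Fin (d + 1))) = (bshiftEquiv (cvM d L mv kk hL) (L ^ r * L ^ kk) μ).symm (x, 0) := by
  simp only [Equiv.addRight_symm, Equiv.coe_addRight, VectorPiece.bshiftEquiv_symm_apply, sub_eq_add_neg]

/-- the lifted block map of the coloured site carrier reads the block of the site. [folklore] -/
theorem liftBlk_scBlk' [NeZero L] (ι : Type) (p : ScX' d L mv kk r hL × ι) : liftBlk (scBlk' d L mv kk r hL) ι p = blockOf (L ^ r * L ^ kk) (cvM d L mv kk hL) p.1 := rfl

/-- the bump on sites IS dag-n15-w4's cover bump at the bond `(x, 0)`. [folklore] -/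
theorem scBump'_eq (k : Fin (d + 1) → ZMod (2 * L)) (x : ScX' d L mv kk r hL) :
    scBump' d L mv kk r hL k x = bcube (2 * L) (coverXi (cvM d L mv kk hL) (L ^ r * L ^ kk) (L ^ mv)) 2 k (x, 0) := rfl

end Dictionary

end Summit.QuantumFields.YangMills.BalabanUVNodes.N15.Gluing

end
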